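import Summits.QuantumFields.YangMills.Theorems.UnitScaleTiltProp7Lane2PatchGeometry
import Literature.MathematicalPhysics.QuantumFieldTheory.Balaban1983to89.B10Eq27TorusAxialLog
import Literature.MathematicalPhysics.QuantumFieldTheory.Balaban1983to89.B4Eq19LatticeOperators
import HarnessLib

/-!
# Route `UnitScaleTilt`, crux K1 «MinimiserStabilityRegPr» (stmt-QuantumFields-19200) — route-R E′ (A′), LANE II «DIVERGENCE RECOVERY AT CURVED `W`» (★★OWNER RULING №23),
# (B7) member geometry [I-9] «(hT_c)»: **A CHART POINT OF THE RECORD BOX LIES WITHIN `2·L^s + 2` COARSE BLOCKS OF ITS CENTRE** — the converse direction of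
# ✓`Prop7Lane2SupportInChart` (support ⟹ chart), i.e. the membership of every inside-chart site ∕ bond in the grid patches of ✓`Prop7Lane2PatchGeometry.sum_grid_sum_patch_le_*`

Cell `ym3-torus` ∕ width seat `ym3-torus-px4` (gen 9, «width 4»; lineage (B8)∕(B9d) box letters px4 g7∕g8).  ★p1 g19 RECIPE v2.1 §(G): «`hT_c` (inside-chart bond ⇒ in `T_c`) …
chart point of `box (w₀+z) R_f` ⇒ block distance ≤ D»; `ym3-torus-px11` g7 2026-08-29 11:57Z «GO».  THEOREMS ONLY (0 `def`, 0 `sorry`); `--supports stmt-QuantumFields-19200 --as helper`,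
count-neutral.  YM₃ on T³ is a ladder rung (R3), NOT d = 4, NOT infinite volume, NOT a mass gap, NOT the Clay problem; nothing here claims (B7), (REC), `hN06`, E′, EX or the gap.

WHY.  In the [I-9] knit the per-patch resource `N_c` is the `c₀`-energy of `y` over the bonds starting at chart points `transl c₀ w`, `w ∈ box zc R_f`, of the base chart `c₀`
(✓`Prop7DivRecoveryCutoffReadings.patch_hN … (T := T_c) (hT := …)`), and the family row `Σ_c N_c ≤ ν‖y‖²` is px9's grid count, whose patches are «fine objects whose
`(K−n)`-block is within coarse cyclic sup-distance `D` of the grid site `κ ↦ g_κ·L^s`».  So the knit needs: chart point of the box ⟹ its block is `D`-close to the centre's block.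
With `ℓ = L^{K−n}`, `R = L^s`, `R_f = (2R+1)ℓ + (ℓ−1)∕2` and the block-tiled centre `zc κ = ℓ·B′_κ + (ℓ−1)∕2` the labels `val(c₀_κ) + w_κ` run over `[ℓ(q₀+B′−2R−1), ℓ(q₀+B′+2R+3))`
(`q₀ = ⌊val(c₀_κ)∕ℓ⌋`), i.e. over the blocks `q₀ + B′_κ + [−(2R+1), 2R+2]`, while the centre's own block is `q₀ + B′_κ` or `q₀ + B′_κ + 1`; hence `D = 2R + 2` (the base point of
record `basePt = embIter (K−n) 0` is a block CENTRE, `val = (ℓ−1)∕2`, so the extra block is really there; RECIPE v2.1 already takes `D := 2L^s + 2`, multiplicity `7³ = 343` for `L^s ≥ 2`).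

WHAT IS PROVED (ns `…Theorems.Prop7Lane2ChartInGrid`):
* §1 (one cycle) ★ `cycDist_intCast_le_natAbs` — `min (↑A − ↑B).val (↑B − ↑A).val ≤ |A − B|` in `ZMod N` for integers `A B`.
* §2 (the member) ★★ `iterBlockOf_transl_eq_intCast` — THE BLOCK OF A CHART POINT: `(iterBlockOf (K−n) (transl x w)) μ = ↑⌊(val(x_μ) + w_μ) ∕ ℓ⌋` (Euclidean quotient in `ℤ`,
  cast to `ZMod N_{K−n}`; wrap-around included since `N₀ = ℓ·N_{K−n}`); ★ `iterBlockOf_corner` — the block of the grid corner `κ ↦ ↑(g_κ·(L^s·ℓ))` is the grid site `κ ↦ ↑(g_κ·L^s)`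
  (`g_κ < 2L^{m+n−s}`): the centres of ✓`exists_partitionOfUnity_grid`∕`exists_cutoffPackage_grid` ARE over px9's grid sites.
* §3 (the record box) `mem_blockBox_bounds` (the label interval of `w ∈ box zc R_f`), ★★★ `cycDist_iterBlockOf_transl_le` — for ANY base chart `x = c₀`, any block vector `B′` and any
  `w ∈ box zc R_f`: `dist((iterBlockOf (K−n) (transl c₀ w)) κ, ↑(⌊val(c₀_κ)∕ℓ⌋ + B′_κ)) ≤ 2L^s + 2` in every direction; ★★ `cycDist_iterBlockOf_transl_le_of_centre` — px9 §3's letters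
  (`B′ := (val c − val c₀)∕ℓ` for any centre site `c`): distance to `iterBlockOf (K−n) c` is `≤ 2L^s + 2`.
* §4 (the grid patches, px9's filter text verbatim at `D := 2·L^s + 2`) ★★ `transl_mem_gridPatch_sites` ∕ ★★ `transl_mem_gridPatch_bonds` — for a centre `c` whose block is the grid
  site `κ ↦ ↑(g_κ·L^s)`, every chart point `transl c₀ w` (`w ∈ box zc R_f`), resp. every bond `⟨transl c₀ w, μ⟩`, is a member of the site ∕ bond patch filter of
  ✓`sum_grid_sum_patch_le_sites` ∕ `_bonds` at `g` and `D = 2L^s + 2` — the `hT` of the knit's `patch_hN`.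
HONEST SCOPE.  Residue ∕ Euclidean-division bookkeeping; nothing of the lattice gauge theory, of print, of (B7)∕(REC)∕`hN06`∕the crux is asserted; rung R3, not Clay; YM gap NOT proved.

References: T. Bałaban, CMP 95 (1984) 17–40 [Balaban1984PropagatorsI] ((1.6) p.18: the block lattices, labels divided by `Lᵏ`); T. Bałaban, CMP 99 (1985) 389–434
[Balaban1985BackgroundPropagators] ((3.100) pp.413–414: localisation at scale `M` and the finite overlap of the cubes); [folklore] (Euclidean division, residues mod `N`).
-/

set_option autoImplicit false

noncomputable section

open scoped BigOperators

namespace Summit.QuantumFields.YangMills.Theorems.Prop7Lane2ChartInGrid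

open Literature.MathematicalPhysics.QuantumFieldTheory.Balaban1983to89
open Literature.MathematicalPhysics.QuantumFieldTheory.Balaban1983to89.T3ContinuumYM3Torus
open Literature.MathematicalPhysics.QuantumFieldTheory.Balaban1983to89.B4Eq19LatticeOperators (Zd box mem_box)
open B5Eq118OneStroke (iterBlockOf val_iterBlockOf)
open B10Eq27TorusAxialLog (transl transl_apply)
open Summit.QuantumFields.YangMills.Theorems.Prop7QprimeCombL2 (sitesPerDir_zero_eq)
open Summit.QuantumFields.YangMills.Theorems.Prop7Lane2PatchGeometry (sitesPerDir_level_eq_mul)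

/-! ## §1 One cycle: the cyclic distance of two integer labels is at most their integer distance -/

section Cycle

variable {N : ℕ} [NeZero N]

/-- ★ **CYCLIC DISTANCE ≤ INTEGER DISTANCE**: for integers `A B`, `min (↑A − ↑B).val (↑B − ↑A).val ≤ |A − B|` in `ZMod N`. [folklore] -/
theorem cycDist_intCast_le_natAbs (A B : ℤ) :
    min (((A : ZMod N)) - (B : ZMod N)).val (((B : ZMod N)) - (A : ZMod N)).val ≤ (A - B).natAbs := by
  -- the value of the cast of a nonnegative integer is at most that integer
  have key : ∀ D : ℤ, 0 ≤ D → (((D : ZMod N)).val : ℤ) ≤ D := by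
    intro D hD
    rw [ZMod.val_intCast]
    have hN : (0 : ℤ) < (N : ℤ) := by exact_mod_cast Nat.pos_of_ne_zero (NeZero.ne N)
    have h1 := Int.emod_add_mul_ediv D (N : ℤ)
    have h2 : 0 ≤ D / (N : ℤ) := Int.ediv_nonneg hD hN.le
    nlinarith
  rcases le_total B A with hBA | hAB
  · refine (min_le_left _ _).trans ?_
    have h := key (A - B) (by omega)
    rw [Int.cast_sub] at h
    have e : ((A - B).natAbs : ℤ) = A - B := Int.natAbs_of_nonneg (by omega)
    omega
  · refine (min_le_right _ _).trans ?_
    have h := key (B - A) (by omega)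
    rw [Int.cast_sub] at h
    have e : ((A - B).natAbs : ℤ) = B - A := by rw [← Int.natAbs_neg, neg_sub]; exact Int.natAbs_of_nonneg (by omega)
    omega

end Cycle

/-! ## §2 The member: the block of a chart point, and the block of a grid corner -/

section Member

variable (F : T3Family) (n K : ℕ)

/-- ★★ **THE BLOCK OF A CHART POINT**: for a base site `x` and an integer vector `w`, the `(K−n)`-block of `transl x w` has coordinates `↑⌊(val(x_μ) + w_μ) ∕ L^{K−n}⌋`
(Euclidean quotient in `ℤ`, cast to `ZMod N_{K−n}`) — the wrap-around of the fine label modulo `N₀ = L^{K−n}·N_{K−n}` shifts the quotient by a multiple of `N_{K−n}`.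
[cite: Balaban1984PropagatorsI, (1.6) p.18] -/
theorem iterBlockOf_transl_eq_intCast (hnK : n ≤ K) (x : Site (F.P K) 0) (w : Zd (F.P K).d) (μ : Fin (F.P K).d) :
    (iterBlockOf (K - n) (transl x w)) μ
      = (((((x μ).val : ℕ) : ℤ) + w μ) / ((F.L ^ (K - n) : ℕ) : ℤ) : ℤ) := by
  -- letters
  have hL : 0 < F.L := by have := F.hL.2; omega
  have hℓpos : 0 < F.L ^ (K - n) := pow_pos hL _
  have hN0 : (F.P K).sitesPerDir 0 = F.L ^ (K - n) * (F.P K).sitesPerDir (K - n) := sitesPerDir_zero_eq F n K hnK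
  set ℓ : ℕ := F.L ^ (K - n) with hℓ
  set Nc : ℕ := (F.P K).sitesPerDir (K - n) with hNc
  have hNc0 : 0 < Nc := Nat.pos_of_ne_zero (NeZero.ne _)
  set a : ℤ := (((x μ).val : ℕ) : ℤ) + w μ with ha
  -- the fine label of the translate is `a mod N₀`
  have hx : (transl x w) μ = ((a : ℤ) : ZMod ((F.P K).sitesPerDir 0)) := by
    rw [transl_apply, ha, Int.cast_add, Int.cast_natCast, ZMod.natCast_zmod_val]
  have hval : ((((transl x w) μ).val : ℕ) : ℤ) = a % ((F.P K).sitesPerDir 0 : ℕ) := by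
    rw [hx, ZMod.val_intCast]
  -- the block label is the fine label divided by `ℓ`
  have hblk : ((iterBlockOf (K - n) (transl x w)) μ).val = ((transl x w) μ).val / ℓ :=
    val_iterBlockOf (P := F.P K) (K - n) (by show K - n ≤ F.m + K; omega) (transl x w) μ
  -- `a = a mod N₀ + N₀·t`, so `a / ℓ = (a mod N₀)/ℓ + Nc·t`
  have hdiv : a / (ℓ : ℤ) = (a % ((F.P K).sitesPerDir 0 : ℕ)) / (ℓ : ℤ) + (Nc : ℤ) * (a / ((F.P K).sitesPerDir 0 : ℕ)) := by
    have h1 := Int.emod_add_mul_ediv a ((F.P K).sitesPerDir 0 : ℕ)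
    conv_lhs => rw [← h1]
    rw [hN0]
    push_cast
    rw [show (a % ((ℓ : ℤ) * (Nc : ℤ)) + (ℓ : ℤ) * (Nc : ℤ) * (a / ((ℓ : ℤ) * (Nc : ℤ))))
        = (a % ((ℓ : ℤ) * (Nc : ℤ)) + (ℓ : ℤ) * ((Nc : ℤ) * (a / ((ℓ : ℤ) * (Nc : ℤ))))) by ring,
      Int.add_mul_ediv_left _ _ (by exact_mod_cast hℓpos.ne')]
  -- compare values in `ZMod Nc`
  rw [← ZMod.natCast_zmod_val ((iterBlockOf (K - n) (transl x w)) μ), hblk, ← Int.cast_natCast, Int.natCast_div, hval, hdiv]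
  push_cast
  rw [ZMod.natCast_self, zero_mul, add_zero]

/-- ★ **THE BLOCK OF A GRID CORNER IS THE GRID SITE**: for `g_κ < 2L^{m+n−s}`, the `(K−n)`-block of the fine corner `κ ↦ ↑(g_κ·(L^s·L^{K−n}))` — the centre set displayed by
✓`Prop7Lane2PartitionOfUnityGrid.exists_partitionOfUnity_grid` — is the coarse site `κ ↦ ↑(g_κ·L^s)` of px9's grid. [cite: Balaban1984PropagatorsI, (1.6) p.18] -/
theorem iterBlockOf_corner (s : ℕ) (hnK : n ≤ K) (hs : s ≤ F.m + n) (g : Fin 3 → ℕ) (hg : ∀ κ, g κ < 2 * F.L ^ (F.m + n - s)) :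
    iterBlockOf (K - n) (fun κ => ((g κ * (F.L ^ s * F.L ^ (K - n)) : ℕ) : ZMod ((F.P K).sitesPerDir 0)) : Site (F.P K) 0)
      = fun κ => ((g κ * F.L ^ s : ℕ) : ZMod ((F.P K).sitesPerDir (K - n))) := by
  have hL : 0 < F.L := by have := F.hL.2; omega
  have hℓpos : 0 < F.L ^ (K - n) := pow_pos hL _
  have hNc : (F.P K).sitesPerDir (K - n) = (2 * F.L ^ (F.m + n - s)) * F.L ^ s := sitesPerDir_level_eq_mul F n K s hnK hs
  have hN0 : (F.P K).sitesPerDir 0 = F.L ^ (K - n) * (F.P K).sitesPerDir (K - n) := sitesPerDir_zero_eq F n K hnK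
  funext κ
  have hlt' : g κ * F.L ^ s < (F.P K).sitesPerDir (K - n) := by
    rw [hNc]; exact Nat.mul_lt_mul_of_pos_right (hg κ) (pow_pos hL _)
  have hlt : g κ * (F.L ^ s * F.L ^ (K - n)) < (F.P K).sitesPerDir 0 := by
    rw [hN0, ← mul_assoc, mul_comm (F.L ^ (K - n))]
    exact Nat.mul_lt_mul_of_pos_right hlt' hℓpos
  apply ZMod.val_injective
  rw [val_iterBlockOf (P := F.P K) (K - n) (by show K - n ≤ F.m + K; omega), ZMod.val_natCast, ZMod.val_natCast,
    Nat.mod_eq_of_lt hlt, Nat.mod_eq_of_lt hlt', show (F.P K).L = F.L from rfl, ← mul_assoc, Nat.mul_div_cancel _ hℓpos]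

end Member

/-! ## §3 The record box: its chart points are within `2L^s + 2` blocks of the centre -/

section Record

variable (F : T3Family) (n K s : ℕ)

/-- **THE LABEL INTERVAL OF THE BLOCK BOX**: `w ∈ box zc R_f` with `zc κ = ℓ·B′_κ + (ℓ−1)∕2`, `R_f = (2R+1)ℓ + (ℓ−1)∕2` (`ℓ = L^{K−n}` odd, `R = L^s`) iff in every direction
`ℓ·(B′_κ − (2R+1)) ≤ w_κ ≤ ℓ·(B′_κ + 2R + 2) − 1` (✓`Prop7Lane2SupportInChart.blockBox_tiled`'s two equations, read as bounds). [cite: Balaban1985Averaging, pp.24-25] -/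
theorem mem_blockBox_bounds (B' w : Zd (F.P K).d)
    (hw : w ∈ box (fun κ : Fin (F.P K).d => ((F.L ^ (K - n) : ℕ) : ℤ) * B' κ + (((F.L ^ (K - n) : ℕ) : ℤ) - 1) / 2)
      ((2 * ((F.L ^ s : ℕ) : ℤ) + 1) * ((F.L ^ (K - n) : ℕ) : ℤ) + (((F.L ^ (K - n) : ℕ) : ℤ) - 1) / 2)) (κ : Fin (F.P K).d) :
    ((F.L ^ (K - n) : ℕ) : ℤ) * (B' κ - (2 * ((F.L ^ s : ℕ) : ℤ) + 1)) ≤ w κ ∧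
      w κ ≤ ((F.L ^ (K - n) : ℕ) : ℤ) * (B' κ + (2 * ((F.L ^ s : ℕ) : ℤ) + 2)) - 1 := by
  obtain ⟨k, hk⟩ : Odd (F.L ^ (K - n)) := F.hL.1.pow
  have hk' : ((F.L ^ (K - n) : ℕ) : ℤ) = 2 * k + 1 := by exact_mod_cast hk
  have h := (mem_box.mp hw) κ
  rw [abs_le] at h
  obtain ⟨h1, h2⟩ := h
  have hdiv : ((((F.L ^ (K - n) : ℕ) : ℤ) - 1) / 2) = k := by rw [hk']; omega
  rw [hdiv] at h1 h2
  rw [hk'] at h1 h2 ⊢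
  constructor <;> nlinarith

/-- ★★★ **A CHART POINT OF THE BLOCK BOX IS WITHIN `2L^s + 2` BLOCKS OF THE BOX'S BLOCK VECTOR**: for any base site `c₀`, block vector `B′`, and `w ∈ box zc R_f`
(`zc κ = ℓ·B′_κ + (ℓ−1)∕2`), in every direction the `(K−n)`-block of `transl c₀ w` is within coarse cyclic distance `2·L^s + 2` of `↑(⌊val(c₀_κ)∕ℓ⌋ + B′_κ)`
(one extra block because `c₀` need not be a block corner — the base point of record is a block centre). [cite: Balaban1985BackgroundPropagators, (3.100) p.413] -/
theorem cycDist_iterBlockOf_transl_le (hnK : n ≤ K) (c₀ : Site (F.P K) 0) (B' w : Zd (F.P K).d)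
    (hw : w ∈ box (fun κ : Fin (F.P K).d => ((F.L ^ (K - n) : ℕ) : ℤ) * B' κ + (((F.L ^ (K - n) : ℕ) : ℤ) - 1) / 2)
      ((2 * ((F.L ^ s : ℕ) : ℤ) + 1) * ((F.L ^ (K - n) : ℕ) : ℤ) + (((F.L ^ (K - n) : ℕ) : ℤ) - 1) / 2)) (κ : Fin (F.P K).d) :
    min ((iterBlockOf (K - n) (transl c₀ w)) κ - (((((c₀ κ).val : ℕ) : ℤ) / ((F.L ^ (K - n) : ℕ) : ℤ) + B' κ : ℤ) : ZMod ((F.P K).sitesPerDir (K - n)))).val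
        ((((((c₀ κ).val : ℕ) : ℤ) / ((F.L ^ (K - n) : ℕ) : ℤ) + B' κ : ℤ) : ZMod ((F.P K).sitesPerDir (K - n))) - (iterBlockOf (K - n) (transl c₀ w)) κ).val ≤ 2 * F.L ^ s + 2 := by
  have hL : 0 < F.L := by have := F.hL.2; omega
  have hℓpos : (0 : ℤ) < ((F.L ^ (K - n) : ℕ) : ℤ) := by exact_mod_cast pow_pos hL _
  obtain ⟨h1, h2⟩ := mem_blockBox_bounds F n K s B' w hw κ
  rw [iterBlockOf_transl_eq_intCast F n K hnK c₀ w κ]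
  refine (cycDist_intCast_le_natAbs _ _).trans ?_
  -- Euclidean divisions of the base label and of the translate's label
  set ℓ : ℤ := ((F.L ^ (K - n) : ℕ) : ℤ) with hℓ
  set v : ℤ := (((c₀ κ).val : ℕ) : ℤ) with hv
  have hq0 := Int.emod_add_mul_ediv v ℓ
  have hr0 := Int.emod_nonneg v hℓpos.ne'
  have hr1 := Int.emod_lt_of_pos v hℓpos
  have hq := Int.emod_add_mul_ediv (v + w κ) ℓ
  have hs0 := Int.emod_nonneg (v + w κ) hℓpos.ne'
  have hs1 := Int.emod_lt_of_pos (v + w κ) hℓpos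
  -- the quotient `(v + w κ)/ℓ` lies in `[v/ℓ + B′ − (2R+1), v/ℓ + B′ + 2R + 2]`
  have hlo : v / ℓ + B' κ - (2 * ((F.L ^ s : ℕ) : ℤ) + 1) ≤ (v + w κ) / ℓ := by
    by_contra hcon
    have h3 : (v + w κ) / ℓ + 1 ≤ v / ℓ + B' κ - (2 * ((F.L ^ s : ℕ) : ℤ) + 1) := by omega
    nlinarith
  have hhi : (v + w κ) / ℓ ≤ v / ℓ + B' κ + (2 * ((F.L ^ s : ℕ) : ℤ) + 2) := by
    by_contra hcon
    have h3 : v / ℓ + B' κ + (2 * ((F.L ^ s : ℕ) : ℤ) + 2) + 1 ≤ (v + w κ) / ℓ := by omega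
    nlinarith
  omega

/-- ★★ **px9's §3 LETTERS — A CHART POINT OF THE BLOCK BOX AROUND ANY CENTRE `c` IS WITHIN `2L^s + 2` BLOCKS OF `c`'s BLOCK**: with `B′ := (val c − val c₀)∕ℓ` (the block vector of
✓`Prop7Lane2SupportInChart.exists_mem_blockBox_of_dist_lt`), every `w ∈ box zc R_f` has `dist((iterBlockOf (K−n) (transl c₀ w)) κ, (iterBlockOf (K−n) c) κ) ≤ 2·L^s + 2` in every
direction (`c`'s own block is `⌊val(c₀_κ)∕ℓ⌋ + B′_κ` or that `+ 1`). [cite: Balaban1985BackgroundPropagators, (3.100) p.413] -/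
theorem cycDist_iterBlockOf_transl_le_of_centre (hnK : n ≤ K) (c₀ c : Site (F.P K) 0) (w : Zd (F.P K).d)
    (hw : w ∈ box (fun κ : Fin (F.P K).d => ((F.L ^ (K - n) : ℕ) : ℤ) * (((((c κ).val : ℕ) : ℤ) - (((c₀ κ).val : ℕ) : ℤ)) / ((F.L ^ (K - n) : ℕ) : ℤ)) + (((F.L ^ (K - n) : ℕ) : ℤ) - 1) / 2)
      ((2 * ((F.L ^ s : ℕ) : ℤ) + 1) * ((F.L ^ (K - n) : ℕ) : ℤ) + (((F.L ^ (K - n) : ℕ) : ℤ) - 1) / 2)) (κ : Fin (F.P K).d) :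
    min ((iterBlockOf (K - n) (transl c₀ w)) κ - (iterBlockOf (K - n) c) κ).val
        ((iterBlockOf (K - n) c) κ - (iterBlockOf (K - n) (transl c₀ w)) κ).val ≤ 2 * F.L ^ s + 2 := by
  have hL : 0 < F.L := by have := F.hL.2; omega
  have hℓpos : (0 : ℤ) < ((F.L ^ (K - n) : ℕ) : ℤ) := by exact_mod_cast pow_pos hL _
  obtain ⟨h1, h2⟩ := mem_blockBox_bounds F n K s (fun κ => ((((c κ).val : ℕ) : ℤ) - (((c₀ κ).val : ℕ) : ℤ)) / ((F.L ^ (K - n) : ℕ) : ℤ)) w hw κ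
  -- both blocks as integer quotients
  have hc : (iterBlockOf (K - n) c) κ = (((((c κ).val : ℕ) : ℤ) / ((F.L ^ (K - n) : ℕ) : ℤ) : ℤ) : ZMod ((F.P K).sitesPerDir (K - n))) := by
    have h := iterBlockOf_transl_eq_intCast F n K hnK c 0 κ
    rw [B10Eq27TorusAxialLog.transl_zero] at h
    rw [h, Pi.zero_apply, add_zero]
  rw [iterBlockOf_transl_eq_intCast F n K hnK c₀ w κ, hc]
  refine (cycDist_intCast_le_natAbs _ _).trans ?_
  -- Euclidean divisions
  set ℓ : ℤ := ((F.L ^ (K - n) : ℕ) : ℤ) with hℓ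
  set v : ℤ := (((c₀ κ).val : ℕ) : ℤ) with hv
  set vc : ℤ := (((c κ).val : ℕ) : ℤ) with hvc
  have hq0 := Int.emod_add_mul_ediv v ℓ
  have hr0 := Int.emod_nonneg v hℓpos.ne'
  have hr1 := Int.emod_lt_of_pos v hℓpos
  have hqc := Int.emod_add_mul_ediv vc ℓ
  have hrc0 := Int.emod_nonneg vc hℓpos.ne'
  have hrc1 := Int.emod_lt_of_pos vc hℓpos
  have hqB := Int.emod_add_mul_ediv (vc - v) ℓ
  have hrB0 := Int.emod_nonneg (vc - v) hℓpos.ne'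
  have hrB1 := Int.emod_lt_of_pos (vc - v) hℓpos
  have hq := Int.emod_add_mul_ediv (v + w κ) ℓ
  have hs0 := Int.emod_nonneg (v + w κ) hℓpos.ne'
  have hs1 := Int.emod_lt_of_pos (v + w κ) hℓpos
  have hlo : vc / ℓ - (2 * ((F.L ^ s : ℕ) : ℤ) + 2) ≤ (v + w κ) / ℓ := by
    by_contra hcon
    have h3 : (v + w κ) / ℓ + 1 ≤ vc / ℓ - (2 * ((F.L ^ s : ℕ) : ℤ) + 2) := by omega
    nlinarith
  have hhi : (v + w κ) / ℓ ≤ vc / ℓ + (2 * ((F.L ^ s : ℕ) : ℤ) + 2) := by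
    by_contra hcon
    have h3 : vc / ℓ + (2 * ((F.L ^ s : ℕ) : ℤ) + 2) + 1 ≤ (v + w κ) / ℓ := by omega
    nlinarith
  omega

end Record

/-! ## §4 The grid patches: inside-chart sites and bonds are members of px9's patch filters at `D = 2·L^s + 2` -/

section Grid

variable (F : T3Family) (n K s : ℕ)

/-- ★★ **(hT_c) FOR SITES**: if the centre `c`'s block is the grid site `κ ↦ ↑(g_κ·L^s)` (✓`iterBlockOf_corner` for the displayed centres), every chart point `transl c₀ w`, `w ∈ box zc R_f`,
belongs to the site patch of ✓`Prop7Lane2PatchGeometry.sum_grid_sum_patch_le_sites` at `g`, `D := 2·L^s + 2` (filter text verbatim). [cite: Balaban1985BackgroundPropagators, (3.100) p.414] -/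
theorem transl_mem_gridPatch_sites (hnK : n ≤ K) (c₀ c : Site (F.P K) 0) (g : Fin 3 → ℕ)
    (hcg : iterBlockOf (K - n) c = fun κ => ((g κ * F.L ^ s : ℕ) : ZMod ((F.P K).sitesPerDir (K - n)))) (w : Zd (F.P K).d)
    (hw : w ∈ box (fun κ : Fin (F.P K).d => ((F.L ^ (K - n) : ℕ) : ℤ) * (((((c κ).val : ℕ) : ℤ) - (((c₀ κ).val : ℕ) : ℤ)) / ((F.L ^ (K - n) : ℕ) : ℤ)) + (((F.L ^ (K - n) : ℕ) : ℤ) - 1) / 2)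
      ((2 * ((F.L ^ s : ℕ) : ℤ) + 1) * ((F.L ^ (K - n) : ℕ) : ℤ) + (((F.L ^ (K - n) : ℕ) : ℤ) - 1) / 2)) :
    transl c₀ w ∈ Finset.univ.filter (fun x : Site (F.P K) 0 => ∀ κ : Fin 3,
          min ((iterBlockOf (K - n) x) κ - ((g κ * F.L ^ s : ℕ) : ZMod ((F.P K).sitesPerDir (K - n)))).val
            ((((g κ * F.L ^ s : ℕ) : ZMod ((F.P K).sitesPerDir (K - n)))) - (iterBlockOf (K - n) x) κ).val ≤ 2 * F.L ^ s + 2) := by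
  refine Finset.mem_filter.mpr ⟨Finset.mem_univ _, fun κ => ?_⟩
  have h := cycDist_iterBlockOf_transl_le_of_centre F n K s hnK c₀ c w hw κ
  rw [hcg] at h
  exact h

/-- ★★ **(hT_c) FOR BONDS**: under the same hypotheses every inside-chart bond `⟨transl c₀ w, μ⟩` belongs to the bond patch of ✓`Prop7Lane2PatchGeometry.sum_grid_sum_patch_le_bonds` at `g`,
`D := 2·L^s + 2` (filter text verbatim) — the `hT` row of the knit's ✓`Prop7DivRecoveryCutoffReadings.patch_hN`. [cite: Balaban1985BackgroundPropagators, (3.100) p.414] -/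
theorem transl_mem_gridPatch_bonds (hnK : n ≤ K) (c₀ c : Site (F.P K) 0) (g : Fin 3 → ℕ)
    (hcg : iterBlockOf (K - n) c = fun κ => ((g κ * F.L ^ s : ℕ) : ZMod ((F.P K).sitesPerDir (K - n)))) (w : Zd (F.P K).d)
    (hw : w ∈ box (fun κ : Fin (F.P K).d => ((F.L ^ (K - n) : ℕ) : ℤ) * (((((c κ).val : ℕ) : ℤ) - (((c₀ κ).val : ℕ) : ℤ)) / ((F.L ^ (K - n) : ℕ) : ℤ)) + (((F.L ^ (K - n) : ℕ) : ℤ) - 1) / 2)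
      ((2 * ((F.L ^ s : ℕ) : ℤ) + 1) * ((F.L ^ (K - n) : ℕ) : ℤ) + (((F.L ^ (K - n) : ℕ) : ℤ) - 1) / 2)) (μ : Fin (F.P K).d) :
    (⟨transl c₀ w, μ⟩ : PBond (F.P K) 0) ∈ Finset.univ.filter (fun b : PBond (F.P K) 0 => ∀ κ : Fin 3,
          min ((iterBlockOf (K - n) b.src) κ - ((g κ * F.L ^ s : ℕ) : ZMod ((F.P K).sitesPerDir (K - n)))).val
            ((((g κ * F.L ^ s : ℕ) : ZMod ((F.P K).sitesPerDir (K - n)))) - (iterBlockOf (K - n) b.src) κ).val ≤ 2 * F.L ^ s + 2) := by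
  refine Finset.mem_filter.mpr ⟨Finset.mem_univ _, fun κ => ?_⟩
  have h := cycDist_iterBlockOf_transl_le_of_centre F n K s hnK c₀ c w hw κ
  rw [hcg] at h
  exact h

end Grid


end Summit.QuantumFields.YangMills.Theorems.Prop7Lane2ChartInGrid

end
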